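import Literature.Probability.LatticeModels.DirichletGreenFunction
import Literature.Probability.LatticeModels.LatticeGraphProofs

/-!
# Stub `stub_greenKernelAsymptotics` of line `rainbow-monomials-in-excursion-kernels` — Part 1:
# reusable lattice potential theory of the Dirichlet Green function `G_Λ = (2d·1 - A_Λ)⁻¹`
# (crux `BoundaryDefectGaussianR`, stmt-CriticalPhenomena-14132)

The registered stub (`G_{V_n}(a_n,b_n)/δ_n² → c·|w′(x)||w′(y)|/|w(x)-w(y)|²` at flat boundary points
of rectilinear polygons) is classical discrete potential theory whose Lean proof needs the
convergence theory of discrete harmonic functions in planar domains (Chelkak–Smirnov 2011,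
Thm. 3.13; Kenyon 2000, Cor. 19), absent from the tree. This file lands the finite, exact part of
that theory for the tree's `Literature.Probability.LatticeModels.dirichletGreen` in every
dimension `d ≥ 1`:

* `dirichletGreen_eq_of_poisson` — UNIQUENESS for the lattice Poisson problem: a function with
  `-Δu = δ_x` on `Λ` vanishing on `∂Λ` is `G_Λ(x,·)` on `Λ`;
* `dirichletGreen_mono` — DOMAIN MONOTONICITY `Λ ⊆ Λ' ⇒ G_Λ ≤ G_{Λ'}` (the comparison
  `rectangle ≤ polygon ≤ half-plane` of the flat-edge argument);
* `dirichletGreen_le_diag`, `dirichletGreen_diag_ge` — `G_Λ(x,y) ≤ G_Λ(y,y)` and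
  `G_Λ(x,x) ≥ 1/(2d)` on `Λ`;
* `poissonKernel_eq_dirichletGreen_of_unique` — at an outer vertex `z ∉ Λ` whose only neighbour
  in `Λ` is `y`, the Poisson kernel (harmonic measure of `z`) is `H_Λ(x,z) = G_Λ(x,y)`: the
  dictionary "Green function at a boundary-row point of a flat edge = harmonic measure of the
  outer vertex" by which the stub is a statement about discrete Poisson kernels;
* `latticeLaplacianZd_comp_equiv`, `dirichletGreen_map_equiv`, `dirichletGreen_translate`,
  `zdGraph_adj_coordReflect_iff` — covariance of `Δ` and `G_Λ` under lattice automorphisms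
  (translations, coordinate reflections `v ↦ update v i (k - v i)`);
* `dirichletGreen_halfSpace_reflect` — the METHOD OF IMAGES: for `Λ'` symmetric under the
  reflection `σ` in the lattice hyperplane `{v i = r}`, the Green function of the half
  `Λ = {v ∈ Λ' : r < v i}` is `G_Λ(x,y) = G_{Λ'}(x,y) - G_{Λ'}(x,σy)`.

All statements are folklore (Lawler 1991, §1.4–1.6; Lawler–Limic 2010, §6.2, §8.1).
-/

noncomputable section

namespace Summit.CriticalPhenomena.CardyFormulaZ2.Cruxes.BoundaryDefectGaussianR.RainbowMonomialsInExcursionKernels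

open Finset Literature.Probability.LatticeModels

variable {d : ℕ}

/-! ### Uniqueness for the lattice Poisson problem -/

/-- **Uniqueness for the Poisson problem on a finite set** (`d ≥ 1`): if `-Δ u = δ_x` on `Λ` and
`u = 0` on the outer boundary `∂Λ`, then `u = G_Λ(x, ·)` on `Λ` (the difference is harmonic on
`Λ` with zero boundary values). [folklore] -/
theorem dirichletGreen_eq_of_poisson (hd : 0 < d) (Λ : Finset (Site d)) (x : Site d)
    {u : Site d → ℝ} (hu : ∀ y ∈ Λ, -latticeLaplacianZd u y = if x = y then 1 else 0)
    (hb : ∀ z ∈ zdOuterBoundary (↑Λ : Set (Site d)), u z = 0) :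
    ∀ y ∈ Λ, u y = dirichletGreen Λ x y := by
  have hharm : IsZdHarmonicOn (u - dirichletGreen Λ x) ↑Λ := by
    intro y hy
    rw [latticeLaplacianZd_sub]
    have h1 := hu y (Finset.mem_coe.1 hy)
    have h2 := neg_latticeLaplacianZd_dirichletGreen hd Λ x (Finset.mem_coe.1 hy)
    linarith
  have hzero : IsZdHarmonicOn (0 : Site d → ℝ) ↑Λ := fun y _ => latticeLaplacianZd_zero y
  have hbd : ∀ z ∈ zdOuterBoundary (↑Λ : Set (Site d)),
      (u - dirichletGreen Λ x) z = (0 : Site d → ℝ) z := by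
    intro z hz
    rw [Pi.sub_apply, Pi.zero_apply, hb z hz,
      dirichletGreen_of_not_mem_right Λ x (fun h => hz.1 h), sub_zero]
  intro y hy
  have key := hharm.eq_of_eq_boundary hd Λ.finite_toSet hzero hbd (Finset.mem_coe.2 hy)
  rw [Pi.sub_apply, Pi.zero_apply, sub_eq_zero] at key
  exact key

/-! ### Monotonicity and diagonal bounds -/

/-- **Domain monotonicity of the Dirichlet Green function** (`d ≥ 1`): `Λ ⊆ Λ'` implies
`G_Λ(x,y) ≤ G_{Λ'}(x,y)` for all `x, y` (the walk killed on leaving `Λ'` visits `y` at least as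
often as the walk killed on leaving `Λ`). Proof: `G_{Λ'}(x,·) - G_Λ(x,·)` is harmonic on `Λ` and
`≥ 0` on `∂Λ`, so the minimum principle applies. [folklore] -/
theorem dirichletGreen_mono (hd : 0 < d) {Λ Λ' : Finset (Site d)} (hΛ : Λ ⊆ Λ') (x y : Site d) :
    dirichletGreen Λ x y ≤ dirichletGreen Λ' x y := by
  by_cases hy : y ∈ Λ
  · have hsuper : IsZdSuperharmonicOn (dirichletGreen Λ' x - dirichletGreen Λ x) ↑Λ := by
      intro v hv
      rw [latticeLaplacianZd_sub]
      have h1 := neg_latticeLaplacianZd_dirichletGreen hd Λ' x (hΛ (Finset.mem_coe.1 hv))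
      have h2 := neg_latticeLaplacianZd_dirichletGreen hd Λ x (Finset.mem_coe.1 hv)
      linarith
    have hbd : ∀ z ∈ zdOuterBoundary (↑Λ : Set (Site d)),
        (0 : ℝ) ≤ (dirichletGreen Λ' x - dirichletGreen Λ x) z := by
      intro z hz
      rw [Pi.sub_apply, dirichletGreen_of_not_mem_right Λ x (fun h => hz.1 h), sub_zero]
      exact dirichletGreen_nonneg hd Λ' x z
    have key := hsuper.ge_of_forall_boundary_ge hd Λ.finite_toSet hbd y (Finset.mem_coe.2 hy)
    rw [Pi.sub_apply] at key
    linarith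
  · rw [dirichletGreen_of_not_mem_right Λ x hy]
    exact dirichletGreen_nonneg hd Λ' x y

/-- **The Green function is maximal on the diagonal** (`d ≥ 1`): `G_Λ(x,y) ≤ G_Λ(y,y)` (the walk
from `x` must first reach `y`). Proof: `G_Λ(·,y)` is harmonic on `Λ ∖ {y}`, vanishes off `Λ`, and
the maximum principle on the finite set `Λ ∖ {y}` applies. [folklore] -/
theorem dirichletGreen_le_diag (hd : 0 < d) (Λ : Finset (Site d)) (x y : Site d) :
    dirichletGreen Λ x y ≤ dirichletGreen Λ y y := by
  rw [dirichletGreen_comm Λ x y]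
  by_cases hxy : x = y
  · rw [hxy]
  by_cases hx : x ∈ Λ
  · set S : Set (Site d) := (↑Λ : Set (Site d)) \ {y} with hS
    have hSfin : S.Finite := Λ.finite_toSet.subset Set.sdiff_subset
    have hsub : IsZdSubharmonicOn (dirichletGreen Λ y) S := by
      intro v hv
      have hvΛ : v ∈ Λ := Finset.mem_coe.1 hv.1
      have hvy : v ≠ y := fun h => hv.2 (by simp [h])
      have h := neg_latticeLaplacianZd_dirichletGreen hd Λ y hvΛ
      rw [if_neg (Ne.symm hvy)] at h
      linarith
    have hbd : ∀ z ∈ zdOuterBoundary S, dirichletGreen Λ y z ≤ dirichletGreen Λ y y := by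
      intro z hz
      by_cases hzy : z = y
      · rw [hzy]
      · have hzΛ : z ∉ Λ := fun h => hz.1 ⟨Finset.mem_coe.2 h, by simpa using hzy⟩
        rw [dirichletGreen_of_not_mem_right Λ y hzΛ]
        exact dirichletGreen_nonneg hd Λ y y
    exact hsub.le_of_forall_boundary_le hd hSfin hbd x ⟨Finset.mem_coe.2 hx, by simpa using hxy⟩
  · rw [dirichletGreen_of_not_mem_right Λ y hx]
    exact dirichletGreen_nonneg hd Λ y y

/-- **Lower bound on the diagonal** (`d ≥ 1`): `G_Λ(x,x) ≥ 1/(2d)` for `x ∈ Λ` — the Poisson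
equation at `x` reads `2d·G_Λ(x,x) - ∑_{w ∼ x} G_Λ(x,w) = 1` and the neighbour sum is `≥ 0`.
[folklore] -/
theorem dirichletGreen_diag_ge (hd : 0 < d) (Λ : Finset (Site d)) {x : Site d} (hx : x ∈ Λ) :
    1 / (2 * (d : ℝ)) ≤ dirichletGreen Λ x x := by
  have h := sum_neighborFinset_dirichletGreen hd Λ x hx
  rw [if_pos rfl] at h
  have hs : 0 ≤ ∑ w ∈ (zdGraph d).neighborFinset x, dirichletGreen Λ x w :=
    Finset.sum_nonneg fun w _ => dirichletGreen_nonneg hd Λ x w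
  have hd' : (0 : ℝ) < 2 * (d : ℝ) := by positivity
  rw [div_le_iff₀ hd']
  nlinarith

/-- The diagonal of the Green function is positive on `Λ` (`d ≥ 1`). [folklore] -/
theorem dirichletGreen_diag_pos (hd : 0 < d) (Λ : Finset (Site d)) {x : Site d} (hx : x ∈ Λ) :
    0 < dirichletGreen Λ x x :=
  lt_of_lt_of_le (by positivity) (dirichletGreen_diag_ge hd Λ hx)

/-! ### Boundary-row Green function = harmonic measure of the outer vertex -/

/-- **Poisson kernel at an outer vertex with a single inner neighbour.** If `z ∉ Λ` is adjacent
to `y` and `y` is the only neighbour of `z` in `Λ` (e.g. `z` the outer vertex below a point `y`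
of the boundary row of a flat edge), then `H_Λ(x,z) = G_Λ(x,y)`: the Green function at a
boundary-row point IS the harmonic measure (exit probability) of the adjacent outer vertex, in the
tree's normalisation `G_Λ = (2d·1 - A_Λ)⁻¹`. [folklore] -/
theorem poissonKernel_eq_dirichletGreen_of_unique (Λ : Finset (Site d)) (x : Site d)
    {z y : Site d} (hz : z ∉ Λ) (hy : (zdGraph d).Adj z y)
    (huniq : ∀ w, (zdGraph d).Adj z w → w ∈ Λ → w = y) :
    poissonKernel Λ x z = dirichletGreen Λ x y := by
  rw [poissonKernel, if_neg hz, Finset.sum_eq_single y]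
  · intro w hw hwy
    have hw' : (zdGraph d).Adj z w := (SimpleGraph.mem_neighborFinset _ _ _).1 hw
    by_cases hwΛ : w ∈ Λ
    · exact absurd (huniq w hw' hwΛ) hwy
    · exact dirichletGreen_of_not_mem_right Λ x hwΛ
  · intro hyn
    exact absurd ((SimpleGraph.mem_neighborFinset _ _ _).2 hy) hyn

/-! ### Covariance under lattice automorphisms -/

/-- **The Laplacian commutes with lattice automorphisms**: for a bijection `φ` of `ℤ^d`
preserving adjacency, `Δ(H ∘ φ)(v) = (ΔH)(φ v)`. [folklore] -/
theorem latticeLaplacianZd_comp_equiv (φ : Site d ≃ Site d)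
    (hφ : ∀ a b, (zdGraph d).Adj (φ a) (φ b) ↔ (zdGraph d).Adj a b) (H : Site d → ℝ)
    (v : Site d) : latticeLaplacianZd (H ∘ φ) v = latticeLaplacianZd H (φ v) := by
  rw [latticeLaplacianZd_eq_sum_neighborFinset, latticeLaplacianZd_eq_sum_neighborFinset]
  exact Finset.sum_equiv φ (fun w => by simp only [SimpleGraph.mem_neighborFinset, hφ])
    (fun w _ => rfl)

/-- **Covariance of the Dirichlet Green function under lattice automorphisms** (`d ≥ 1`):
`G_{φ(Λ)}(φ x, φ y) = G_Λ(x, y)` for every adjacency-preserving bijection `φ` of `ℤ^d`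
(translations, coordinate permutations and reflections). Proof: `G_{φ(Λ)}(φ x, φ ·)` solves the
Poisson problem of `Λ` with pole `x`, so uniqueness applies. [folklore] -/
theorem dirichletGreen_map_equiv (hd : 0 < d) (φ : Site d ≃ Site d)
    (hφ : ∀ a b, (zdGraph d).Adj (φ a) (φ b) ↔ (zdGraph d).Adj a b) (Λ : Finset (Site d))
    (x y : Site d) :
    dirichletGreen (Λ.map φ.toEmbedding) (φ x) (φ y) = dirichletGreen Λ x y := by
  have hmem : ∀ v, φ v ∈ Λ.map φ.toEmbedding ↔ v ∈ Λ := fun v => by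
    rw [Finset.mem_map_equiv, Equiv.symm_apply_apply]
  by_cases hy : y ∈ Λ
  · refine dirichletGreen_eq_of_poisson hd Λ x
      (u := dirichletGreen (Λ.map φ.toEmbedding) (φ x) ∘ φ) ?_ ?_ y hy
    · intro v hv
      rw [latticeLaplacianZd_comp_equiv φ hφ,
        neg_latticeLaplacianZd_dirichletGreen hd _ (φ x) ((hmem v).2 hv)]
      simp only [φ.injective.eq_iff]
    · intro z hz
      have hzΛ : z ∉ Λ := fun h => hz.1 h
      exact dirichletGreen_of_not_mem_right _ _ (fun h => hzΛ ((hmem z).1 h))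
  · rw [dirichletGreen_of_not_mem_right Λ x hy,
      dirichletGreen_of_not_mem_right _ _ (fun h => hy ((hmem y).1 h))]

/-- **Translation covariance**: `G_{Λ + t}(x + t, y + t) = G_Λ(x, y)` (`d ≥ 1`). [folklore] -/
theorem dirichletGreen_translate (hd : 0 < d) (Λ : Finset (Site d)) (t x y : Site d) :
    dirichletGreen (Λ.map (Site.shift t).toEmbedding) (x + t) (y + t) = dirichletGreen Λ x y :=
  dirichletGreen_map_equiv hd (Site.shift t) (zdGraph_adj_shift_iff t) Λ x y

/-- The coordinate reflection `σ_{i,k} : v ↦ (v with vᵢ replaced by k - vᵢ)` (reflection of `ℤ^d`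
in the affine hyperplane `vᵢ = k/2`; for `k = 2r` it fixes the lattice hyperplane `vᵢ = r`) is an
involution. [folklore] -/
theorem coordReflect_involutive (i : Fin d) (k : ℤ) :
    Function.Involutive (fun v : Site d => Function.update v i (k - v i)) := by
  intro v
  ext j
  by_cases hj : j = i
  · subst hj; simp
  · simp [hj]

/-- Coordinate reflections are lattice automorphisms: `σ a ∼ σ b ↔ a ∼ b` (they preserve the
`ℓ¹`-distance, `zdGraph_adj_iff_norm_holds`). [folklore] -/
theorem zdGraph_adj_coordReflect_iff (i : Fin d) (k : ℤ) (a b : Site d) :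
    (zdGraph d).Adj (Function.update a i (k - a i)) (Function.update b i (k - b i)) ↔
      (zdGraph d).Adj a b := by
  rw [(zdGraph_adj_iff_norm_holds _ _ : (zdGraph d).Adj (Function.update a i (k - a i)) _ ↔ _),
    (zdGraph_adj_iff_norm_holds a b : (zdGraph d).Adj a b ↔ _)]
  have key : ∀ j, |Function.update a i (k - a i) j - Function.update b i (k - b i) j| =
      |a j - b j| := by
    intro j
    by_cases hj : j = i
    · subst hj
      simp only [Function.update_self, sub_sub_sub_cancel_left, abs_sub_comm]
    · simp [hj]
  simp_rw [key]

/-- **Method of images across a lattice hyperplane** (`d ≥ 1`). Let `σ v = (v with vᵢ ↦ 2r - vᵢ)`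
be the reflection in the lattice hyperplane `{vᵢ = r}` and let the finite set `Λ'` be
`σ`-invariant. Then the Dirichlet Green function of the open half `Λ = {v ∈ Λ' : r < vᵢ}` (whose
walk is killed on the hyperplane and on leaving `Λ'`) is
`G_Λ(x,y) = G_{Λ'}(x,y) - G_{Λ'}(x,σy)` for `x, y` strictly above the hyperplane: the odd
reflection of `G_{Λ'}(x,·)` solves the Poisson problem of `Λ`. This is the exact identity behind
the half-plane computation `G(0,r·e₁) ≈ 1/(π r²)` of the flat-edge kernel (Lawler–Limic 2010,
§8.1). [folklore] -/
theorem dirichletGreen_halfSpace_reflect (hd : 0 < d) (i : Fin d) (r : ℤ) (Λ' : Finset (Site d))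
    (hsymm : ∀ v ∈ Λ', Function.update v i (2 * r - v i) ∈ Λ') {x y : Site d} (hxi : r < x i)
    (hyi : r < y i) :
    dirichletGreen (Λ'.filter fun v => r < v i) x y =
      dirichletGreen Λ' x y - dirichletGreen Λ' x (Function.update y i (2 * r - y i)) := by
  classical
  set σ : Site d → Site d := fun v => Function.update v i (2 * r - v i) with hσ
  have hσi : ∀ v, σ v i = 2 * r - v i := fun v => by simp [hσ]
  have hσinv : Function.Involutive σ := coordReflect_involutive i (2 * r)
  -- membership in `Λ'` is `σ`-invariant
  have hmemσ : ∀ v, σ v ∈ Λ' ↔ v ∈ Λ' := fun v =>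
    ⟨fun h => by
      have h2 : σ (σ v) ∈ Λ' := hsymm (σ v) h
      rwa [hσinv v] at h2, fun h => hsymm v h⟩
  set Λ := Λ'.filter fun v => r < v i with hΛ
  by_cases hx : x ∈ Λ'
  · by_cases hy : y ∈ Λ'
    · have hyΛ : y ∈ Λ := Finset.mem_filter.2 ⟨hy, hyi⟩
      -- the odd reflection `u = G_{Λ'}(x,·) - G_{Λ'}(x,σ·)` solves the Poisson problem of `Λ`
      symm
      refine dirichletGreen_eq_of_poisson hd Λ x
        (u := fun v => dirichletGreen Λ' x v - dirichletGreen Λ' x (σ v)) ?_ ?_ y hyΛ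
      · intro v hv
        have hv' : v ∈ Λ' := (Finset.mem_filter.1 hv).1
        have hvi : r < v i := (Finset.mem_filter.1 hv).2
        have h1 := neg_latticeLaplacianZd_dirichletGreen hd Λ' x hv'
        have h2 := neg_latticeLaplacianZd_dirichletGreen hd Λ' x ((hmemσ v).2 hv')
        have hcomp : latticeLaplacianZd (fun w => dirichletGreen Λ' x (σ w)) v =
            latticeLaplacianZd (dirichletGreen Λ' x) (σ v) := by
          have := latticeLaplacianZd_comp_equiv (hσinv.toPerm σ)
            (fun a b => by
              rw [Function.Involutive.coe_toPerm]
              exact zdGraph_adj_coordReflect_iff i (2 * r) a b)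
            (dirichletGreen Λ' x) v
          simpa only [Function.Involutive.coe_toPerm, Function.comp_def] using this
        have hne : x ≠ σ v := by
          intro h
          have := congrArg (fun w : Site d => w i) h
          simp only [hσi] at this
          omega
        rw [if_neg hne] at h2
        have hsub : latticeLaplacianZd (fun w => dirichletGreen Λ' x w - dirichletGreen Λ' x (σ w)) v
            = latticeLaplacianZd (dirichletGreen Λ' x) v -
              latticeLaplacianZd (fun w => dirichletGreen Λ' x (σ w)) v :=
          latticeLaplacianZd_sub (dirichletGreen Λ' x) (fun w => dirichletGreen Λ' x (σ w)) v
        rw [hsub, hcomp]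
        linarith
      · -- zero on the outer boundary of `Λ`: either on the hyperplane (`σ z = z`) or outside `Λ'`
        intro z hz
        obtain ⟨hzΛ, v, hv, j, hj⟩ := hz
        have hv' := Finset.mem_filter.1 (Finset.mem_coe.1 hv)
        by_cases hz' : z ∈ Λ'
        · have hzi : ¬ r < z i := fun h => hzΛ (Finset.mem_coe.2 (Finset.mem_filter.2 ⟨hz', h⟩))
          -- `z ∼ v` with `r < v i` and `z i ≤ r` forces `z i = r`
          have hzi' : z i = r := by
            have hvz : |v i - z i| ≤ 1 := by
              rcases hj with h | h
              · rw [h]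
                by_cases hji : j = i
                · subst hji; simp
                · simp [hji]
              · rw [h]
                by_cases hji : j = i
                · subst hji; simp
                · simp [hji]
            have := abs_le.1 hvz
            omega
          have hσz : σ z = z := by
            ext l
            by_cases hl : l = i
            · subst hl; simp [hσ, hzi']; ring
            · simp [hσ, hl]
          show dirichletGreen Λ' x z - dirichletGreen Λ' x (σ z) = 0
          rw [hσz, sub_self]
        · show dirichletGreen Λ' x z - dirichletGreen Λ' x (σ z) = 0
          rw [dirichletGreen_of_not_mem_right Λ' x hz',
            dirichletGreen_of_not_mem_right Λ' x (fun h => hz' ((hmemσ z).1 h)), sub_self]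
    · -- `y ∉ Λ'`: all three terms vanish
      have hyΛ : y ∉ Λ := fun h => hy (Finset.mem_filter.1 h).1
      rw [dirichletGreen_of_not_mem_right _ x hyΛ, dirichletGreen_of_not_mem_right Λ' x hy,
        dirichletGreen_of_not_mem_right Λ' x (fun h => hy ((hmemσ y).1 h)), sub_self]
  · -- `x ∉ Λ'`: all three terms vanish
    have hxΛ : x ∉ Λ := fun h => hx (Finset.mem_filter.1 h).1
    rw [dirichletGreen_of_not_mem_left _ hxΛ, dirichletGreen_of_not_mem_left Λ' hx,
      dirichletGreen_of_not_mem_left Λ' hx, sub_self]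

/-! ### Registered sub-goal of stub 5 carried by this file -/

/-- **Sub-goal `s5_methodOfImages` of stub 5** (registered on stmt-CriticalPhenomena-14132): the
method of images for the Dirichlet Green function across a lattice hyperplane, in every dimension
`d ≥ 1` — the exact identity by which the flat-edge kernel of the half-plane is read off the
whole-plane potential kernel (`G(0, r e₁) = ¼[a(r,2) - a(r,0)] ≈ 1/(π r²)`, Lawler–Limic 2010
§8.1), here for finite symmetric sets (`dirichletGreen_halfSpace_reflect`). [folklore] -/
theorem s5_methodOfImages : ∀ (d : ℕ), 0 < d → ∀ (i : Fin d) (r : ℤ) (Λ' : Finset (Literature.Probability.LatticeModels.Site d)), (∀ v ∈ Λ', Function.update v i (2 * r - v i) ∈ Λ') → ∀ (x y : Literature.Probability.LatticeModels.Site d), r < x i → r < y i → Literature.Probability.LatticeModels.dirichletGreen (Λ'.filter fun v => r < v i) x y = Literature.Probability.LatticeModels.dirichletGreen Λ' x y - Literature.Probability.LatticeModels.dirichletGreen Λ' x (Function.update y i (2 * r - y i)) :=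
  fun _ hd i r Λ' hsymm _ _ hxi hyi => dirichletGreen_halfSpace_reflect hd i r Λ' hsymm hxi hyi

end Summit.CriticalPhenomena.CardyFormulaZ2.Cruxes.BoundaryDefectGaussianR.RainbowMonomialsInExcursionKernels

end
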